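import Mathlib
import Summits.Ventures.PercRepro.TriangleCapOneTriangleNineA

/-!
# PercRepro — THE ONE-TRIANGLE COUNT WITH THE OUTER DEGREES, AND THE `r = 3` ONE-TRIANGLE CASE PAID BY THE OUTER
VERTICES (p3, gen 37, towards gen 38; part 96)

`S = {u, v, w}` the only triangle, `q` the outer vertices (no neighbour in `S`), `d(z) = degIn Sᶜ z`.  The far count
of `TriangleCapOneTriangleNineA` loses `2 Σ_{outer} d(z)` in the step `Σ s d ≤ Σ d`; keeping it exactly
(`Σ_{z ∉ S} s(z) d(z) = Σ_{z ∉ S} d(z) − Σ_{outer} d(z)`, since `s ∈ {0, 1}`) gives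
**`one_triangle_deficit_lower_outer`**: `Σ_p deficit(p) + 6 ≥ 6q + 2m + 2 Σ_{outer} d`.  Hence THREE BELOW THE
DIAGONAL (`Σ_v d(v)² + 3 (k − 4) ≤ m k`, the `r = 3` term of the closed form) for the one-triangle graphs with
`2m ≥ 6k − 24` (every cell `m = a (k − a) − 3` with `a ≥ 3` and `k ≥ 9`) as soon as `6q + 2 Σ_{outer} d ≥ 12`
(**`one_triangle_stability_three_of_outer`**: two outer vertices, or one of outside degree `≥ 3`), and outright when
`2m ≥ 6k − 12` (**`one_triangle_stability_three_of_three_mul`**).  The residues — no outer vertex; one outer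
vertex of outside degree `≤ 2` — are the private graph and a deletion (paper §10be).  Axioms: standard.
-/

namespace PercRepro

namespace TriangleCap

namespace C047

open Finset

variable {V : Type*} [Fintype V] [DecidableEq V]

/-- `Σ_{z ∉ S} s(z) d(z) + Σ_{outer} d(z) = Σ_{z ∉ S} d(z)` when every `s(z) ≤ 1` (`s = degIn S`, `d = degIn Sᶜ`). -/
theorem sum_degIn_mul_add_sum_outer (D : SimpleGraph V) [DecidableRel D.Adj] (S : Finset V)
    (hone : ∀ z ∈ Sᶜ, degIn D S z ≤ 1) :
    ∑ z ∈ Sᶜ, degIn D S z * degIn D Sᶜ z + ∑ z ∈ Sᶜ.filter (fun z => degIn D S z = 0), degIn D Sᶜ z =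
      ∑ z ∈ Sᶜ, degIn D Sᶜ z := by
  rw [← sum_filter_add_sum_filter_not Sᶜ (fun z => degIn D S z = 0) (fun z => degIn D S z * degIn D Sᶜ z),
    ← sum_filter_add_sum_filter_not Sᶜ (fun z => degIn D S z = 0) (fun z => degIn D Sᶜ z)]
  have h0 : ∑ z ∈ Sᶜ.filter (fun z => degIn D S z = 0), degIn D S z * degIn D Sᶜ z = 0 := by
    apply sum_eq_zero
    intro z hz
    rw [(mem_filter.mp hz).2, zero_mul]
  have h1 : ∑ z ∈ Sᶜ.filter (fun z => ¬ degIn D S z = 0), degIn D S z * degIn D Sᶜ z =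
      ∑ z ∈ Sᶜ.filter (fun z => ¬ degIn D S z = 0), degIn D Sᶜ z := by
    apply sum_congr rfl
    intro z hz
    have hz' := mem_filter.mp hz
    have := hone z hz'.1
    have e1 : degIn D S z = 1 := by omega
    rw [e1, one_mul]
  rw [h0, h1]
  ring

/-- **`Σ deficit + 6 ≥ 6 q + 2 m + 2 Σ_{outer} d`** for the only triangle `S = {u, v, w}`: `q` the number of outer
vertices and `d(z) = degIn Sᶜ z` their outside degrees. -/
theorem one_triangle_deficit_lower_outer (D : SimpleGraph V) [DecidableRel D.Adj] (hK : K4mFree D) {u v w : V}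
    (huv : D.Adj u v) (huw : D.Adj u w) (hvw : D.Adj v w) :
    6 * ((({u, v, w} : Finset V)ᶜ).filter (fun z => degIn D {u, v, w} z = 0)).card + 2 * D.edgeFinset.card +
      2 * ∑ z ∈ (({u, v, w} : Finset V)ᶜ).filter (fun z => degIn D {u, v, w} z = 0),
        degIn D ({u, v, w} : Finset V)ᶜ z ≤
      ∑ p ∈ adjPairsAll D, deficit D p + 6 := by
  set S : Finset V := {u, v, w} with hS
  have h3 : S.card = 3 := card_triple huv.ne huw.ne hvw.ne
  have hcl := clique_triple D huv huw hvw
  have hcount := one_triangle_far_count D huv huw hvw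
  rw [← hS] at hcount
  have hQ : adjPairs D S = 6 := by
    rw [adjPairs_eq_sum_degIn, sum_congr rfl (fun x hx => degIn_self_of_clique D h3 hcl hx), sum_const, h3,
      smul_eq_mul]
  have hdens := two_mul_card_edges_eq_adjPairs_add D S
  rw [hQ] at hdens
  have hone : ∀ z ∈ Sᶜ, degIn D S z ≤ 1 := fun z hz =>
    degIn_le_one_of_triangle D hK huv huw hvw (mem_compl.mp hz)
  have hsd := sum_degIn_mul_add_sum_outer D S hone
  have hs : ∑ z ∈ Sᶜ, degIn D S z + (Sᶜ.filter (fun z => degIn D S z = 0)).card = Sᶜ.card := by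
    rw [card_filter, ← sum_add_distrib, card_eq_sum_ones]
    apply sum_congr rfl
    intro z hz
    have := hone z hz
    by_cases h0 : degIn D S z = 0
    · simp only [h0, if_true]
    · simp only [h0, if_false]; omega
  omega

/-- **THREE BELOW THE DIAGONAL, ONE TRIANGLE, PAID BY THE OUTER VERTICES (every `k`):** `K₄⁻`-free, the only
triangle `u v w`, `2m ≥ 6k − 24` and `6q + 2 Σ_{outer} d ≥ 12` ⇒ `Σ_v d(v)² + 3 (k − 4) ≤ m k`. -/
theorem one_triangle_stability_three_of_outer (D : SimpleGraph V) [DecidableRel D.Adj] (hK : K4mFree D)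
    {u v w : V} (huv : D.Adj u v) (huw : D.Adj u w) (hvw : D.Adj v w)
    (hT : ∀ a b c, D.Adj a b → D.Adj a c → D.Adj b c → a = u ∨ a = v ∨ a = w)
    (hm : 6 * Fintype.card V ≤ 2 * D.edgeFinset.card + 24)
    (hpay : 12 ≤ 6 * ((({u, v, w} : Finset V)ᶜ).filter (fun z => degIn D {u, v, w} z = 0)).card +
      2 * ∑ z ∈ (({u, v, w} : Finset V)ᶜ).filter (fun z => degIn D {u, v, w} z = 0),
        degIn D ({u, v, w} : Finset V)ᶜ z) :
    ∑ v, deg D v * deg D v + 3 * (Fintype.card V - 4) ≤ D.edgeFinset.card * Fintype.card V := by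
  have hlow := one_triangle_deficit_lower_outer D hK huv huw hvw
  have h6 := card_triangles3_le_six D hT
  have hid := two_mul_sum_deg_sq_add_sum_deficit D
  have hmk : 2 * (D.edgeFinset.card * Fintype.card V) = 2 * D.edgeFinset.card * Fintype.card V := by ring
  have hk3 : 3 ≤ Fintype.card V := by
    have : ({u, v, w} : Finset V).card ≤ Fintype.card V := card_le_univ _
    rw [card_triple huv.ne huw.ne hvw.ne] at this
    exact this
  omega

/-- **THREE BELOW THE DIAGONAL, ONE TRIANGLE, `2m ≥ 6k − 12` (every `k ≥ 4`).** -/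
theorem one_triangle_stability_three_of_three_mul (D : SimpleGraph V) [DecidableRel D.Adj] (hK : K4mFree D)
    {u v w : V} (huv : D.Adj u v) (huw : D.Adj u w) (hvw : D.Adj v w)
    (hT : ∀ a b c, D.Adj a b → D.Adj a c → D.Adj b c → a = u ∨ a = v ∨ a = w)
    (hk : 4 ≤ Fintype.card V) (hm : 6 * Fintype.card V ≤ 2 * D.edgeFinset.card + 12) :
    ∑ v, deg D v * deg D v + 3 * (Fintype.card V - 4) ≤ D.edgeFinset.card * Fintype.card V := by
  have hlow := one_triangle_deficit_lower_outer D hK huv huw hvw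
  have h6 := card_triangles3_le_six D hT
  have hid := two_mul_sum_deg_sq_add_sum_deficit D
  have hmk : 2 * (D.edgeFinset.card * Fintype.card V) = 2 * D.edgeFinset.card * Fintype.card V := by ring
  omega

end C047

end TriangleCap

end PercRepro
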